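import Summits.AnomalousDissipation.AnomalousDissipation.Theorems.QuarticTightness.Negative.Anatomy
import Summits.AnomalousDissipation.AnomalousDissipation.Theorems.QuarticGate.Negative.MomentumRow

/-!
# Strategy census — typed companion (crux-strategist s1, stmt-AnomalousDissipation-14331
`QuarticTightness`; routes QuarticLadder r3 / MomentParity; 2026-08-17)

Companion to `Cruxes/QuarticTightness/STRATEGY-CENSUS.md`. Everything here is sorry-free LOGIC over
the landed vocabulary of `Theorems/QuarticTightness/Negative/Anatomy.lean` (`GateHyp`, `LadderConcl`,
`InvariantFamily`, `IsLadderWitness`, `IsInvariantWitness`); it certifies the SHAPE claims of the census: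

* §0 FRAME. `QuarticTightness` (QT) sits between two zeroth-law-grade statements and is implied by
  either: `quarticTightness_of_not_quarticGate` (¬ rank-2 crux ⇒ QT, vacuously) and
  `quarticTightness_of_UEF` (the universal Galerkin-ensemble floor ⇒ QT; `UEF` is, by the live line's
  PROVED `universalHorizonLoud_iff_universalEnsembleFloor`, exactly its open stub S6).
  `quarticTightness_of_dichotomy`: pointwise in `(f, ν, E, ε)` the crux is `¬GateHyp ∨ Floor`.
  `quarticTightness_of_gateFloor`: the gate-relative floor (lead c4's S6*) ⇒ QT.
* §S STRENGTHEN. `UEF_of_lossyMonotoneFloor`: a downward-in-`ν` monotonicity of loud bounded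
  invariant families (constant loss `C`) would reduce the whole `ν → 0` content to ONE viscosity per
  force (`FixedViscosityFloor`, a fixed-`ν` statement). `not_exactMonotoneFloor` (§S1, sorry-free,
  std axioms) REFUTES the exact-budget version: the max dissipation over invariant laws at bounded
  energy PEAKS at the critical viscosity where the laminar Dirac of the shear force saturates
  Cauchy–Schwarz, and is unattainable below it (equality cases force `u = K_a` a.s., whose linear
  row is `¼ ≠ 0`). The census explains why the lossy version has no mechanism (no small parameter
  in `ν`).
* §D DECOMPOSITION. Three typed splits with their glue PROVED (`quarticTightness_of_base_of_climb`,
  `gateFloor_of_noCondensation_of_loudSelection`, `UEF_of_reference_of_transfer`) and, for each, the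
  SANDWICH lemma showing that the hard child is implied outright by the floor it is meant to produce
  (`levelwiseClimbAt_of_eventualInvariant`, `loudSelection_of_floor`, `forceTransfer_of_UEF`): the hard
  child is the crux's conclusion re-dressed, so the split has no leverage.
* §N NEGATION. `not_quarticTightness_of_quietGateForce`: the typed shape of a refutation line — one
  gate-passing force with `N`-uniform bounded-energy quietness; the census records why no candidate
  force exists (CubicCertificateBarrier + every catalogued laminarisation is quadratic and planar).

Apart from §S1 no new mathematics is claimed; the point is that every switch lands on
`EnsembleFloor f ν` for arbitrary gate-passing `f`, i.e. on S6/S6* of the live line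
`Lines/Ideate3Sketch.lean`.
-/

namespace Summit.AnomalousDissipation.AnomalousDissipation.Cruxes.QuarticTightness.StrategyCensus

set_option linter.dupNamespace false
set_option linter.unusedVariables false

open MeasureTheory Filter Topology
open scoped ENNReal InnerProductSpace RealInnerProductSpace
open Literature.Analysis.FunctionSpaces Literature.Analysis.FluidPDE
open Summit.AnomalousDissipation.AnomalousDissipation.Theses.MomentParity
open Summit.AnomalousDissipation.AnomalousDissipation.Theorems
open Summit.AnomalousDissipation.AnomalousDissipation.Theorems.QuarticGate.Negative
open Summit.AnomalousDissipation.AnomalousDissipation.Theorems.QuarticTightness.Negative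

noncomputable section

open Summit.AnomalousDissipation.AnomalousDissipation.Theorems.CubicParityLoud.Negative (T3 R3 H3)

/-! ## §0 Frame: the crux between `¬QuarticGate` and the universal ensemble floor -/

/-- Admissible force: smooth, divergence-free, mean-zero. -/
def Admissible (f : T3 → R3) : Prop :=
  Torus.IsSmooth f ∧ Torus.IsDivFree f ∧ Torus.HasZeroMean f

/-- Positive null viscosity sequence. -/
def NullSeq (ν : ℕ → ℝ) : Prop := (∀ j, 0 < ν j) ∧ Tendsto ν atTop (𝓝 0)

/-- The Galerkin-ensemble FLOOR of the force `f` along the sequence `ν`: a loud bounded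
Galerkin-invariant family for SOME budgets (the conclusion of the crux read through the badges). -/
def EnsembleFloor (f : T3 → R3) (ν : ℕ → ℝ) : Prop :=
  ∃ E' ε' : ℝ, 0 < ε' ∧ InvariantFamily f ν E' ε'

/-- UEF — the UNIVERSAL ensemble floor: every nonzero admissible force is loud-bounded along every
null sequence. By the live line's proved `universalHorizonLoud_iff_universalEnsembleFloor` this is
exactly its open stub S6 `stub_universalHorizonLoud`. -/
def UEF : Prop :=
  ∀ f : T3 → R3, Admissible f → f ≠ 0 → ∀ ν : ℕ → ℝ, NullSeq ν → EnsembleFloor f ν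

/-- The GATE-RELATIVE floor (lead c4's reshaped stub S6*): gate hypothesis ⇒ floor, force by force. -/
def GateFloor : Prop :=
  ∀ f : T3 → R3, Admissible f → ∀ (ν : ℕ → ℝ) (E ε : ℝ), NullSeq ν → 0 < ε →
    GateHyp f ν E ε → EnsembleFloor f ν

/-- S6* ⇒ QT (the converse needs the κ-free moment closure `LadderConcl → InvariantFamily`,
lead c4's planned `invariantWitness_of_ladderWitnesses`; not used here). -/
theorem quarticTightness_of_gateFloor (h : GateFloor) : QuarticTightness := by
  rw [quarticTightness_iff]
  intro f hfs hfd hfz ν E ε hν hν0 hε hH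
  obtain ⟨E', ε', hε', hI⟩ := h f ⟨hfs, hfd, hfz⟩ ν E ε ⟨hν, hν0⟩ hε hH
  exact ⟨E', ε', hε', ladderConcl_of_invariantFamily hI⟩

/-- The gate hypothesis with `ε > 0` excludes the zero force (energy row `ε ≤ ‖f‖₂√E`): this is the
ONLY use any known line makes of the hypothesis. -/
theorem ne_zero_of_gateHyp {f : T3 → R3} {ν : ℕ → ℝ} {E ε : ℝ} (hε : 0 < ε)
    (hH : GateHyp f ν E ε) : f ≠ 0 := by
  intro hf
  subst hf
  obtain ⟨N, μ, hμ⟩ := (hH 0).exists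
  have key := hμ.eps_le_force (f := 0) (by simp)
  simp only [Pi.zero_apply, norm_zero, ne_eq, OfNat.ofNat_ne_zero, not_false_eq_true, zero_pow,
    integral_zero, Real.sqrt_zero, zero_mul] at key
  linarith

/-- UEF ⇒ S6* (hypothesis used only for `f ≠ 0`). -/
theorem gateFloor_of_UEF (h : UEF) : GateFloor :=
  fun f hf ν E ε hν hε hH => h f hf (ne_zero_of_gateHyp hε hH) ν hν

/-- UEF ⇒ QT: the live line's composition in one line. -/
theorem quarticTightness_of_UEF (h : UEF) : QuarticTightness :=
  quarticTightness_of_gateFloor (gateFloor_of_UEF h)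

/-- ¬(rank-2 crux) ⇒ QT, vacuously: the OTHER zeroth-law-grade endpoint (a universal ORDER-4 quietness
theorem would prove the crux and kill route QuarticLadder's deciding path at binder 1). -/
theorem quarticTightness_of_not_quarticGate (h : ¬ QuarticGate) : QuarticTightness := by
  rw [quarticTightness_iff]
  intro f hfs hfd hfz ν E ε hν hν0 hε hH
  exact absurd (quarticGate_iff.2 ⟨f, hfs, hfd, hfz, ν, E, ε, hν, hν0, hε, hH⟩) h

/-- The crux pointwise: at every `(f, ν, E, ε)` EITHER the gate fails OR the floor holds. Both
disjuncts are summit-grade for a generic force (census §0); no third option exists. -/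
theorem quarticTightness_of_dichotomy
    (h : ∀ f : T3 → R3, Admissible f → ∀ (ν : ℕ → ℝ) (E ε : ℝ), NullSeq ν → 0 < ε →
      ¬ GateHyp f ν E ε ∨ EnsembleFloor f ν) :
    QuarticTightness := by
  rw [quarticTightness_iff]
  intro f hfs hfd hfz ν E ε hν hν0 hε hH
  rcases h f ⟨hfs, hfd, hfz⟩ ν E ε ⟨hν, hν0⟩ hε with hno | ⟨E', ε', hε', hI⟩
  · exact absurd hH hno
  · exact ⟨E', ε', hε', ladderConcl_of_invariantFamily hI⟩

/-! ## §S Strengthen: what a monotone-in-`ν` floor would buy, typed -/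

/-- Monotonicity of the invariant-witness clauses in the budgets. -/
theorem invariantWitness_mono {f : T3 → R3} {ν : ℝ} {N : ℕ} {R E E' ε ε' : ℝ} {μ : Measure H3}
    (h : IsInvariantWitness f ν N R E ε μ) (hE : E ≤ E') (hε : ε' ≤ ε) :
    IsInvariantWitness f ν N R E' ε' μ :=
  ⟨h.1, h.2.1, h.2.2.1, h.2.2.2.1, h.2.2.2.2.1.trans hE, hε.trans h.2.2.2.2.2⟩

/-- S⁺ (exact budgets): loud bounded invariant families persist DOWNWARD in `ν` with the SAME budgets.
FALSE (census §Strengthen S1, paper proof): for the shear force `K` the laminar Dirac at the critical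
viscosity `ν_c = ‖K‖₂/(4π²√E')` is an invariant witness saturating the Cauchy–Schwarz ceiling
`ε' = ‖K‖₂√E'`, and at every `ν < ν_c` a witness with dissipation `≥ ‖K‖₂√E'` and energy `≤ E'` must be
that same Dirac (equality case of Cauchy–Schwarz), which is not steady at `ν ≠ ν_c`. -/
def ExactMonotoneFloor : Prop :=
  ∀ f : T3 → R3, Admissible f → ∀ (E' ε' ν₁ ν₂ : ℝ), 0 < ν₂ → ν₂ ≤ ν₁ →
    (∃ R : ℝ, ∃ᶠ N in atTop, ∃ μ, IsInvariantWitness f ν₁ N R E' ε' μ) →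
    (∃ R : ℝ, ∃ᶠ N in atTop, ∃ μ, IsInvariantWitness f ν₂ N R E' ε' μ)

/-- S⁺ (lossy): the same with a one-shot constant loss `C` (NOT iterated). Open; no mechanism
(census §Strengthen S2: `NS_{ν₂}` is an O(1) perturbation of `NS_{ν₁}` on loud states). -/
def LossyMonotoneFloor : Prop :=
  ∃ C : ℝ, 1 ≤ C ∧ ∀ f : T3 → R3, Admissible f → ∀ (E' ε' ν₁ ν₂ : ℝ), 0 < ν₂ → ν₂ ≤ ν₁ →
    (∃ R : ℝ, ∃ᶠ N in atTop, ∃ μ, IsInvariantWitness f ν₁ N R E' ε' μ) →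
    (∃ R : ℝ, ∃ᶠ N in atTop, ∃ μ, IsInvariantWitness f ν₂ N R (C * E') (ε' / C) μ)

/-- Base for the monotone induction: at ONE fixed viscosity every nonzero force has a loud bounded
invariant family with `ν`-DEPENDENT budgets (true: steady Galerkin Diracs, `exists_galerkinRHS_eq_zero`
+ the energy row; cf. Disproof §F for the Kolmogorov force). Stated, not proved, here. -/
def FixedViscosityFloor : Prop :=
  ∀ f : T3 → R3, Admissible f → f ≠ 0 → ∀ ν : ℝ, 0 < ν →
    ∃ E₀ ε₀ : ℝ, 0 < ε₀ ∧ ∃ R : ℝ, ∃ᶠ N in atTop, ∃ μ, IsInvariantWitness f ν N R E₀ ε₀ μ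

/-- **What monotonicity would buy: everything.** A lossy monotone floor + the fixed-viscosity base
give UEF (hence QT): apply the base at `M = sup_j ν_j` and transport down to every `ν_j`. So the
`ν → 0` content of the crux is EXACTLY the absence of any comparison principle between `NS_ν` at
different viscosities. [folklore] -/
theorem UEF_of_lossyMonotoneFloor (hm : LossyMonotoneFloor) (hb : FixedViscosityFloor) : UEF := by
  intro f hf hf0 ν hν
  obtain ⟨hνpos, hν0⟩ := hν
  obtain ⟨C, hC, hmono⟩ := hm
  obtain ⟨M, hM⟩ := hν0.bddAbove_range
  have hM' : ∀ j, ν j ≤ M := fun j => hM ⟨j, rfl⟩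
  have hMpos : 0 < M := (hνpos 0).trans_le (hM' 0)
  obtain ⟨E₀, ε₀, hε₀, hbase⟩ := hb f hf hf0 M hMpos
  have hCpos : 0 < C := one_pos.trans_le hC
  exact ⟨C * E₀, ε₀ / C, div_pos hε₀ hCpos, fun j => hmono f hf E₀ ε₀ M (ν j) (hνpos j) (hM' j) hbase⟩

/-- The exact version would buy the same, with no loss (for the record). -/
theorem UEF_of_exactMonotoneFloor (hm : ExactMonotoneFloor) (hb : FixedViscosityFloor) : UEF := by
  intro f hf hf0 ν hν
  obtain ⟨hνpos, hν0⟩ := hν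
  obtain ⟨M, hM⟩ := hν0.bddAbove_range
  have hM' : ∀ j, ν j ≤ M := fun j => hM ⟨j, rfl⟩
  have hMpos : 0 < M := (hνpos 0).trans_le (hM' 0)
  obtain ⟨E₀, ε₀, hε₀, hbase⟩ := hb f hf hf0 M hMpos
  exact ⟨E₀, ε₀, hε₀, fun j => hm f hf E₀ ε₀ M (ν j) (hνpos j) (hM' j) hbase⟩

/-! ## §D Decomposition: three typed splits, each with its glue and its sandwich -/

/-! ### D1 — levelwise moment ladder in a fixed ball (card `casimir-gap-ladder`, triage-sharpened) -/

/-- The levelwise climb at `(f, ν_j)` in the ball `B_R` with frozen budgets: for all large levels,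
an order-`d` bounded witness upgrades to order `d + 1` AT THE SAME LEVEL (`d ≥ 4`). -/
def LevelwiseClimbAt (f : T3 → R3) (ν : ℝ) (R E ε : ℝ) (N₁ : ℕ) : Prop :=
  ∀ N, N₁ ≤ N → ∀ d, 4 ≤ d →
    (∃ μ, IsLadderWitness f ν N R d E ε μ) → (∃ μ, IsLadderWitness f ν N R (d + 1) E ε μ)

/-- Universal climb: every admissible force, every viscosity of a null sequence, every radius. -/
def UniversalClimb : Prop :=
  ∀ f : T3 → R3, Admissible f → ∀ (ν : ℕ → ℝ) (E ε : ℝ), NullSeq ν → 0 < ε →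
    ∀ j : ℕ, ∀ R : ℝ, ∃ N₁ : ℕ, LevelwiseClimbAt f (ν j) R E ε N₁

/-- Base (bounded-support self-improvement at order 4, `BSSI` of the card): the gate hypothesis gives
order-4 witnesses of BOUNDED support, frequently in `N`, with new `j`-uniform budgets. -/
def BoundedSupportBase : Prop :=
  ∀ f : T3 → R3, Admissible f → ∀ (ν : ℕ → ℝ) (E ε : ℝ), NullSeq ν → 0 < ε → GateHyp f ν E ε →
    ∃ E₁ ε₁ : ℝ, 0 < ε₁ ∧ ∀ j : ℕ, ∃ R : ℝ, ∃ᶠ N in atTop, ∃ μ, IsLadderWitness f (ν j) N R 4 E₁ ε₁ μ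

/-- Order-monotonicity of ladder witnesses (fewer tests). -/
theorem ladderWitness_anti {f : T3 → R3} {ν : ℝ} {N : ℕ} {R : ℝ} {d d' : ℕ} {E ε : ℝ}
    {μ : Measure H3} (h : IsLadderWitness f ν N R d E ε μ) (hd : d' ≤ d) :
    IsLadderWitness f ν N R d' E ε μ :=
  ⟨h.1, h.2.1, h.2.2.1, h.2.2.2.1.mono hd, h.2.2.2.2.1, h.2.2.2.2.2⟩

/-- **Glue of D1 (proved): base + universal levelwise climb ⇒ QT.** At each good level `N ≥ N₁` the
order-4 witness climbs through every order by induction on `d`; small orders come for free. -/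
theorem quarticTightness_of_base_of_climb (hb : BoundedSupportBase) (hc : UniversalClimb) :
    QuarticTightness := by
  rw [quarticTightness_iff]
  intro f hfs hfd hfz ν E ε hν hν0 hε hH
  obtain ⟨E₁, ε₁, hε₁, hbase⟩ := hb f ⟨hfs, hfd, hfz⟩ ν E ε ⟨hν, hν0⟩ hε hH
  refine ⟨E₁, ε₁, hε₁, fun j => ?_⟩
  obtain ⟨R, hR⟩ := hbase j
  obtain ⟨N₁, hN₁⟩ := hc f ⟨hfs, hfd, hfz⟩ ν E₁ ε₁ ⟨hν, hν0⟩ hε₁ j R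
  refine ⟨R, (hR.and_eventually (eventually_ge_atTop N₁)).mono ?_⟩
  rintro N ⟨h4, hN⟩ d
  -- climb by induction on the order, starting from the order-4 witness
  have climb : ∀ n : ℕ, ∃ μ, IsLadderWitness f (ν j) N R (4 + n) E₁ ε₁ μ := by
    intro n
    induction n with
    | zero => simpa using h4
    | succ n ih => exact hN₁ N hN (4 + n) (by omega) ih
  rcases le_or_gt d 4 with hd | hd
  · obtain ⟨μ, hμ⟩ := h4
    exact ⟨μ, ladderWitness_anti hμ hd⟩
  · obtain ⟨μ, hμ⟩ := climb (d - 4)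
    exact ⟨μ, by rwa [Nat.add_sub_cancel' hd.le] at hμ⟩

/-- **Sandwich of D1 (proved): the climb is implied outright by eventual invariant loudness in the same
ball** — the hypothesis `W_d` is not even looked at. With the base, base + climb ⇒ ladder ⇒ (κ-free
closure) invariant loudness frequently in `N`; so modulo `∃ᶠ/∀ᶠ N` the climb IS the floor of `f`. -/
theorem levelwiseClimbAt_of_eventualInvariant {f : T3 → R3} {ν R E ε : ℝ} {N₁ : ℕ}
    (h : ∀ N, N₁ ≤ N → ∃ μ, IsInvariantWitness f ν N R E ε μ) : LevelwiseClimbAt f ν R E ε N₁ := by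
  intro N hN d _ _
  obtain ⟨μ, hμ⟩ := h N hN
  exact ⟨μ, hμ.isLadderWitness (d + 1)⟩

/-! ### D2 — no condensation + loud selection (card `flux-pinned-limit`, its salvageable half) -/

/-- NO CONDENSATION at `(f, ν)`: `j`-uniformly BOUNDED-energy invariant Galerkin laws exist, frequently
in `N`, loudness not required (floor `0`). Half of the floor; itself zeroth-law-grade for a generic
force (census §Decomposition D2) and the subject of other routes' bounded-energy cruxes. -/
def NoCondensation (f : T3 → R3) (ν : ℕ → ℝ) : Prop :=
  ∃ E' : ℝ, ∀ j : ℕ, ∃ R : ℝ, ∃ᶠ N in atTop, ∃ μ, IsInvariantWitness f (ν j) N R E' 0 μ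

/-- LOUD SELECTION at `(f, ν)`: if bounded invariant laws exist then LOUD bounded ones do. -/
def LoudSelection (f : T3 → R3) (ν : ℕ → ℝ) : Prop :=
  NoCondensation f ν → EnsembleFloor f ν

/-- **Glue of D2 (proved).** -/
theorem gateFloor_of_noCondensation_of_loudSelection
    (h₁ : ∀ f : T3 → R3, Admissible f → ∀ (ν : ℕ → ℝ) (E ε : ℝ), NullSeq ν → 0 < ε →
      GateHyp f ν E ε → NoCondensation f ν)
    (h₂ : ∀ f : T3 → R3, Admissible f → ∀ ν : ℕ → ℝ, NullSeq ν → LoudSelection f ν) : GateFloor :=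
  fun f hf ν E ε hν hε hH => h₂ f hf ν hν (h₁ f hf ν E ε hν hε hH)

/-- The floor implies no condensation (drop the loudness). -/
theorem noCondensation_of_floor {f : T3 → R3} {ν : ℕ → ℝ} (h : EnsembleFloor f ν) :
    NoCondensation f ν := by
  obtain ⟨E', ε', hε', hI⟩ := h
  refine ⟨E', fun j => ?_⟩
  obtain ⟨R, hR⟩ := hI j
  exact ⟨R, hR.mono fun N ⟨μ, hμ⟩ => ⟨μ, invariantWitness_mono hμ le_rfl hε'.le⟩⟩

/-- **Sandwich of D2 (proved): loud selection is implied outright by the floor** (its hypothesis is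
discarded) and, given no-condensation, is equivalent to it — the hard child is the whole floor. -/
theorem loudSelection_of_floor {f : T3 → R3} {ν : ℕ → ℝ} (h : EnsembleFloor f ν) :
    LoudSelection f ν :=
  fun _ => h

theorem loudSelection_iff_floor {f : T3 → R3} {ν : ℕ → ℝ} (hnc : NoCondensation f ν) :
    LoudSelection f ν ↔ EnsembleFloor f ν :=
  ⟨fun h => h hnc, loudSelection_of_floor⟩

/-! ### D3 — one reference force + force-to-force transfer -/

/-- The floor of `f` along EVERY null sequence (for the reference force this is the `∀ν`-form of the
rank-4 sibling crux `GalerkinInvariantLoud`, stmt-14283, which has its own lead). -/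
def FloorEverySeq (f : T3 → R3) : Prop :=
  ∀ ν : ℕ → ℝ, NullSeq ν → EnsembleFloor f ν

open CubicParityLoud.Negative in
/-- FORCE TRANSFER: loudness of the reference shear force `cos(2πx₁)e₂` propagates to every nonzero
admissible force. No mechanism beyond the symmetry orbit (scaling `u ↦ λu, t ↦ t/λ, ν ↦ λν, f ↦ λ²f`,
cube isometries, translations); census §Decomposition D3. -/
def ForceTransfer : Prop :=
  ∀ f : T3 → R3, Admissible f → f ≠ 0 → FloorEverySeq shearForce → FloorEverySeq f

open CubicParityLoud.Negative in
/-- **Glue of D3 (proved).** -/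
theorem UEF_of_reference_of_transfer (h₁ : FloorEverySeq shearForce) (h₂ : ForceTransfer) : UEF :=
  fun f hf hf0 ν hν => h₂ f hf hf0 h₁ ν hν

/-- **Sandwich of D3 (proved): the transfer child is implied outright by UEF** (reference unused). -/
theorem forceTransfer_of_UEF (h : UEF) : ForceTransfer :=
  fun f hf hf0 _ ν hν => h f hf hf0 ν hν

/-! ## §N Negation: the typed shape of a refutation line -/

/-- **A refutation is ONE gate-passing force with `N`-uniform bounded-energy quietness along a null
sequence** (`not_quarticTightness_iff` of Anatomy, direction used by a refutation line). The first
stub of any refutation line is `hquiet` for a concrete `f₀`; census §Negation records why no candidate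
`f₀` exists (every catalogued laminarisation mechanism is a quadratic certificate and planar; a
gate-passing force admits NO certificate of degree ≤ 3 — `not_gateHyp_of_cubicCertificates`). -/
theorem not_quarticTightness_of_quietGateForce {f₀ : T3 → R3} (hf : Admissible f₀) {ν : ℕ → ℝ}
    {E ε : ℝ} (hν : NullSeq ν) (hε : 0 < ε) (hgate : GateHyp f₀ ν E ε)
    (hquiet : ∀ E' ε' : ℝ, 0 < ε' → ¬ LadderConcl f₀ ν E' ε') : ¬ QuarticTightness :=
  not_quarticTightness_iff.2 ⟨f₀, hf.1, hf.2.1, hf.2.2, ν, E, ε, hν.1, hν.2, hε, hgate, hquiet⟩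

/-- …and such a force has, in particular, NO floor along that sequence (it refutes the invariant loud
family of its own force, `not_invariantFamily_of_not_ladderConcl`). -/
theorem not_floor_of_quiet {f₀ : T3 → R3} {ν : ℕ → ℝ}
    (hquiet : ∀ E' ε' : ℝ, 0 < ε' → ¬ LadderConcl f₀ ν E' ε') : ¬ EnsembleFloor f₀ ν := by
  rintro ⟨E', ε', hε', hI⟩
  exact hquiet E' ε' hε' (ladderConcl_of_invariantFamily hI)

/-! ## §S1 (kernel-checked): the exact monotone floor is FALSE — Cauchy–Schwarz peak at the
critical viscosity

Force `K = kolField 1` (the shear mode `cos(2πx₁)e₀`), amplitude `a = (4π²)⁻¹`, state `u* = K_a`,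
budgets `E' = a²/2` (the energy of `u*`) and `ε' = (8π²)⁻¹ = ‖K‖₂√E'` (the Cauchy–Schwarz CEILING of
injection at energy `≤ E'`). At `ν₁ = 1` the Dirac `δ_{u*}` is an invariant witness with these budgets
(Anatomy §F). At `ν₂ = 1/2` ANY invariant witness with these budgets realises equality in
`∫(K,u)dμ ≤ ‖K‖₂∫‖u‖dμ ≤ ‖K‖₂(∫‖u‖²dμ)^{1/2} ≤ ‖K‖₂√E'`, hence `u = u*` `μ`-a.s. (equality cases),
and the linear row against the band test `K` evaluates to `(1 − 4π²ν₂a)·½ = ¼ ≠ 0`. -/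

section ExactMonotoneRefutation

open Summit.AnomalousDissipation.AnomalousDissipation.Theorems.CubicParityLoud.Negative
  (integrable_pairing sq_integral_norm_le norm_toLp_eq_sqrt L2T3)

/-- The shear mode is a band test at every level `≥ 1`. -/
theorem isBandTest_kolField_of_le (a : ℝ) {N : ℕ} (hN : 1 ≤ N) : IsBandTest N (kolField a) :=
  ⟨isSmooth_kolField a, isDivFree_kolField a, hasZeroMean_kolField a, fun k hk => by
    have h := isLevel_kolState a hN k hk
    rwa [mFourierCoeff_congr_ae (coe_kolState_ae a)] at h⟩

/-- The laminar Dirac of Anatomy §F is an INVARIANT witness (all orders at once). -/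
theorem isInvariantWitness_dirac_kolState {ν : ℝ} (hν : 0 < ν) {N : ℕ} (hN : 1 ≤ N) :
    IsInvariantWitness (kolField 1) ν N ‖kolState (4 * Real.pi ^ 2 * ν)⁻¹‖
      ((4 * Real.pi ^ 2 * ν)⁻¹ ^ 2 / 2) (8 * Real.pi ^ 2 * ν)⁻¹
      (Measure.dirac (kolState (4 * Real.pi ^ 2 * ν)⁻¹)) := by
  have h := fun d => isLadderWitness_dirac_kolState hν hN d
  obtain ⟨hp, hl, hb, -, hE, hD⟩ := h 0
  exact ⟨hp, hl, hb, fun m g P hg => (h (P.totalDegree + 1)).2.2.2.1 m g P hg le_rfl, hE, hD⟩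

/-- Force splitting of the generator pairing: only the force term changes. -/
theorem nsGeneratorPairing_force_split (ν : ℝ) (f f' : T3 → R3) (u : H3) (w : T3 → R3) :
    Torus.nsGeneratorPairing ν f u w =
      Torus.nsGeneratorPairing ν f' u w + ((∫ x, ⟪f x, w x⟫_ℝ) - ∫ x, ⟪f' x, w x⟫_ℝ) := by
  simp only [Torus.nsGeneratorPairing]
  ring

/-- `∫ ⟪K₁, K₁⟫ = ½`. -/
theorem integral_inner_kolField_one_self : ∫ x, ⟪kolField 1 x, kolField 1 x⟫_ℝ = 1 / 2 := by
  simp_rw [real_inner_self_eq_norm_sq]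
  rw [integral_norm_sq_kolField]
  norm_num

/-- The linear row of `K₁` against itself on a state a.e. equal to `K_a`: `(1 − 4π²νa)·½`. -/
theorem nsGeneratorPairing_kolField_one_self {ν a : ℝ} {U : H3}
    (hU : ((U.1 : L2T3) : T3 → R3) =ᵐ[volume] kolField a) :
    Torus.nsGeneratorPairing ν (kolField 1) U (kolField 1) =
      (1 - 4 * Real.pi ^ 2 * ν * a) * (1 / 2) := by
  rw [nsGeneratorPairing_force_split ν (kolField 1) (kolField (4 * Real.pi ^ 2 * ν * a)) U (kolField 1),
    nsGeneratorPairing_kolField hU (isSmooth_kolField 1), zero_add]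
  have hb : ∫ x, ⟪kolField (4 * Real.pi ^ 2 * ν * a) x, kolField 1 x⟫_ℝ =
      (4 * Real.pi ^ 2 * ν * a) * ∫ x, ⟪kolField 1 x, kolField 1 x⟫_ℝ := by
    rw [show kolField (4 * Real.pi ^ 2 * ν * a) = kolField ((4 * Real.pi ^ 2 * ν * a) * 1) by
      rw [mul_one]]
    simp_rw [kolField_mul, real_inner_smul_left]
    rw [integral_const_mul]
  rw [hb, integral_inner_kolField_one_self]
  ring

/-- **Below the critical viscosity the ceiling is unattainable.** No invariant witness of `K₁` at
`ν₂ = 1/2`, any level `N ≥ 1`, any radius, has energy `≤ a²/2` and dissipation `≥ (8π²)⁻¹`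
(`a = (4π²)⁻¹`). [folklore] -/
theorem no_invariantWitness_half {N : ℕ} (hN : 1 ≤ N) {R : ℝ} {μ : Measure H3}
    (hμ : IsInvariantWitness (kolField 1) (1 / 2) N R
      ((4 * Real.pi ^ 2 * (1 : ℝ))⁻¹ ^ 2 / 2) (8 * Real.pi ^ 2 * (1 : ℝ))⁻¹ μ) : False := by
  obtain ⟨hP, hlev, hball, hstat, hE, hD⟩ := hμ
  have hπ := Real.pi_pos
  set a : ℝ := (4 * Real.pi ^ 2 * (1 : ℝ))⁻¹ with ha_def
  have ha : 0 < a := by positivity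
  set K : T3 → R3 := kolField 1 with hK_def
  have hK : MemLp K 2 volume := (isSmooth_kolField 1).memLp 2
  set KL : L2T3 := hK.toLp K with hKL_def
  have h2 : Integrable (fun u : H3 => ‖u‖ ^ 2) μ := integrable_norm_pow_of_ae_le hball 2
  have h1 : Integrable (fun u : H3 => ‖u‖) μ := by
    simpa using integrable_norm_pow_of_ae_le hball 1
  -- (1) energy row: dissipation = mean injection
  have hrow : Torus.ensembleDissipation (1 / 2) μ = ∫ u, Torus.pairing u.1 K ∂μ :=
    ensembleDissipation_eq_of_polyStationary K hK hlev h2 le_rfl (fun m g P hg _ => hstat m g P hg)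
  -- (2) the force norm and the ceiling identity `‖K‖₂ √E' = ε'`
  have hKn : ‖KL‖ = Real.sqrt (1 / 2) := by
    rw [hKL_def, norm_toLp_eq_sqrt hK, hK_def, integral_norm_sq_kolField]
    norm_num
  have hKn0 : 0 < ‖KL‖ := by rw [hKn]; positivity
  have hsa : Real.sqrt (a ^ 2 / 2) = a * Real.sqrt (1 / 2) := by
    rw [show a ^ 2 / 2 = a ^ 2 * (1 / 2) by ring, Real.sqrt_mul (sq_nonneg a), Real.sqrt_sq ha.le]
  have hceil : ‖KL‖ * Real.sqrt (a ^ 2 / 2) = (8 * Real.pi ^ 2 * (1 : ℝ))⁻¹ := by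
    rw [hKn, hsa, show Real.sqrt (1 / 2) * (a * Real.sqrt (1 / 2)) =
      a * (Real.sqrt (1 / 2) * Real.sqrt (1 / 2)) by ring,
      Real.mul_self_sqrt (by norm_num : (0 : ℝ) ≤ 1 / 2), ha_def]
    field_simp
    ring
  -- (3) the Cauchy–Schwarz chain `ε' ≤ D = I ≤ ‖K‖ s ≤ ‖K‖ √e ≤ ‖K‖ √E' = ε'`
  set s : ℝ := ∫ u, ‖u‖ ∂μ with hs_def
  set e : ℝ := Torus.ensembleEnergy μ with he_def
  have he_int : ∫ u, ‖u‖ ^ 2 ∂μ = e := by rw [he_def]; rfl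
  have hI_le : ∫ u, Torus.pairing u.1 K ∂μ ≤ ‖KL‖ * s := by
    have h := integral_mono (integrable_pairing hK h1) (h1.mul_const ‖KL‖)
      (fun u => (le_abs_self _).trans (Torus.abs_pairing_coe_le hK u))
    rw [integral_mul_const] at h
    linarith
  have hs0 : 0 ≤ s := integral_nonneg fun u => norm_nonneg u
  have he0 : 0 ≤ e := he_int ▸ integral_nonneg fun u => by positivity
  have hs_le : s ≤ Real.sqrt e :=
    (le_abs_self _).trans (Real.abs_le_sqrt (he_int ▸ sq_integral_norm_le h2))
  have hA : (8 * Real.pi ^ 2 * (1 : ℝ))⁻¹ ≤ ‖KL‖ * s := hD.trans (hrow ▸ hI_le)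
  have hB : ‖KL‖ * s ≤ ‖KL‖ * Real.sqrt e := mul_le_mul_of_nonneg_left hs_le hKn0.le
  have hC : ‖KL‖ * Real.sqrt e ≤ ‖KL‖ * Real.sqrt (a ^ 2 / 2) :=
    mul_le_mul_of_nonneg_left (Real.sqrt_le_sqrt hE) hKn0.le
  have h_eq1 : ‖KL‖ * s = ‖KL‖ * Real.sqrt (a ^ 2 / 2) :=
    le_antisymm (hB.trans hC) (by rw [hceil]; exact hA)
  have h_eq2 : ‖KL‖ * Real.sqrt e = ‖KL‖ * Real.sqrt (a ^ 2 / 2) :=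
    le_antisymm hC (by rw [hceil]; exact hA.trans hB)
  have hs_eq : s = Real.sqrt (a ^ 2 / 2) := mul_left_cancel₀ hKn0.ne' h_eq1
  have hsqe : Real.sqrt e = Real.sqrt (a ^ 2 / 2) := mul_left_cancel₀ hKn0.ne' h_eq2
  have he_eq : e = a ^ 2 / 2 := (Real.sqrt_inj he0 (by positivity)).1 hsqe
  have hI_eq : ∫ u, Torus.pairing u.1 K ∂μ = ‖KL‖ * s :=
    le_antisymm hI_le (by rw [h_eq1, hceil, ← hrow]; exact hD)
  -- (4) equality cases, almost everywhere
  have hae1 : ∀ᵐ u ∂μ, Torus.pairing u.1 K = ‖u‖ * ‖KL‖ := by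
    have hnn : 0 ≤ᵐ[μ] fun u : H3 => ‖u‖ * ‖KL‖ - Torus.pairing u.1 K :=
      ae_of_all _ fun u => sub_nonneg.2 ((le_abs_self _).trans (Torus.abs_pairing_coe_le hK u))
    have hint : Integrable (fun u : H3 => ‖u‖ * ‖KL‖ - Torus.pairing u.1 K) μ :=
      (h1.mul_const _).sub (integrable_pairing hK h1)
    have h0 : ∫ u, (‖u‖ * ‖KL‖ - Torus.pairing u.1 K) ∂μ = 0 := by
      rw [integral_sub (h1.mul_const _) (integrable_pairing hK h1), integral_mul_const, hI_eq]
      ring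
    filter_upwards [(integral_eq_zero_iff_of_nonneg_ae hnn hint).1 h0] with u hu
    simp only [Pi.zero_apply] at hu
    linarith
  have hae2 : ∀ᵐ u ∂μ, ‖u‖ = s := by
    have hsplit : (fun u : H3 => (‖u‖ - s) ^ 2) = fun u => ‖u‖ ^ 2 - (2 * s) * ‖u‖ + s ^ 2 := by
      funext u; ring
    have hint : Integrable (fun u : H3 => (‖u‖ - s) ^ 2) μ := by
      rw [hsplit]; exact (h2.sub (h1.const_mul _)).add (integrable_const _)
    have hA : Integrable (fun u : H3 => ‖u‖ ^ 2 - 2 * s * ‖u‖) μ := h2.sub (h1.const_mul _)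
    have hvar : ∫ u, (‖u‖ - s) ^ 2 ∂μ = e - s ^ 2 := by
      rw [hsplit, integral_add hA (integrable_const _), integral_sub h2 (h1.const_mul _),
        integral_const_mul, integral_const, he_int]
      simp only [smul_eq_mul, probReal_univ, one_mul]
      have hss : (∫ u, ‖u‖ ∂μ) = s := hs_def.symm
      linear_combination (-2 * s) * hss
    have hes : e - s ^ 2 = 0 := by
      rw [hs_eq, Real.sq_sqrt (by positivity), he_eq]
      ring
    filter_upwards [(integral_eq_zero_iff_of_nonneg_ae (ae_of_all _ fun u => sq_nonneg (‖u‖ - s))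
      hint).1 (hvar.trans hes)] with u hu
    simp only [Pi.zero_apply] at hu
    nlinarith [sq_nonneg (‖u‖ - s)]
  -- (5) hence `u = K_a` almost everywhere (equality case of Cauchy–Schwarz in `L²`)
  have hcoef : ‖KL‖⁻¹ * s = a := by
    rw [hKn, hs_eq, hsa]
    field_simp
  have hae3 : ∀ᵐ u ∂μ, ((u.1 : L2T3) : T3 → R3) =ᵐ[volume] kolField a := by
    filter_upwards [hae1, hae2] with u hu1 hu2
    have hnorm : ‖(u.1 : L2T3)‖ = ‖u‖ := Submodule.coe_norm u
    have hinner : ⟪(u.1 : L2T3), KL⟫_ℝ = ‖(u.1 : L2T3)‖ * ‖KL‖ := by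
      rw [← Torus.pairing_eq_inner hK, hnorm]
      exact hu1
    have hpar : ‖KL‖ • (u.1 : L2T3) = ‖(u.1 : L2T3)‖ • KL := (inner_eq_norm_mul_iff_real).1 hinner
    have hu_eq : (u.1 : L2T3) = a • KL := by
      have h' : (u.1 : L2T3) = ‖KL‖⁻¹ • (‖(u.1 : L2T3)‖ • KL) := by
        rw [← hpar, smul_smul, inv_mul_cancel₀ hKn0.ne', one_smul]
      rw [h', smul_smul, hnorm, hu2, hcoef]
    rw [hu_eq]
    filter_upwards [Lp.coeFn_smul a KL, hK.coeFn_toLp] with x hx1 hx2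
    rw [hx1, Pi.smul_apply, hx2, hK_def, ← kolField_mul, mul_one]
  -- (6) the linear row against the band test `K` is the constant `(1 − 4π²ν₂a)·½ = ¼ ≠ 0`
  obtain ⟨-, hrowK⟩ := hstat 1 (fun _ => K) (MvPolynomial.X 0) (fun _ => isBandTest_kolField_of_le 1 hN)
  simp only [polyGrad_X] at hrowK
  have hconst : ∀ᵐ u ∂μ, Torus.nsGeneratorPairing (1 / 2) K u K =
      (1 - 4 * Real.pi ^ 2 * (1 / 2) * a) * (1 / 2) := by
    filter_upwards [hae3] with u hu
    rw [hK_def, nsGeneratorPairing_kolField_one_self hu]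
  have hval : ∫ u, Torus.nsGeneratorPairing (1 / 2) K u K ∂μ =
      (1 - 4 * Real.pi ^ 2 * (1 / 2) * a) * (1 / 2) := by
    rw [integral_congr_ae hconst, integral_const]
    simp only [smul_eq_mul, probReal_univ, one_mul]
  have hquarter : (1 - 4 * Real.pi ^ 2 * (1 / 2) * a) * (1 / 2) = 1 / 4 := by
    rw [ha_def]
    field_simp
    ring
  rw [hrowK, hquarter] at hval
  norm_num at hval

/-- **`ExactMonotoneFloor` is false** (census §Strengthen S1): the laminar Dirac of the shear force
carries the exact-ceiling budgets at `ν₁ = 1`, nothing carries them at `ν₂ = 1/2`. [folklore] -/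
theorem not_exactMonotoneFloor : ¬ ExactMonotoneFloor := by
  intro hmono
  have hhyp : ∃ R : ℝ, ∃ᶠ N in atTop, ∃ μ, IsInvariantWitness (kolField 1) 1 N R
      ((4 * Real.pi ^ 2 * (1 : ℝ))⁻¹ ^ 2 / 2) (8 * Real.pi ^ 2 * (1 : ℝ))⁻¹ μ :=
    ⟨_, (eventually_ge_atTop 1).frequently.mono fun N hN =>
      ⟨_, isInvariantWitness_dirac_kolState one_pos hN⟩⟩
  have hadm : Admissible (kolField 1) :=
    ⟨isSmooth_kolField 1, isDivFree_kolField 1, hasZeroMean_kolField 1⟩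
  obtain ⟨R, hR⟩ := hmono (kolField 1) hadm _ _ 1 (1 / 2) (by norm_num) (by norm_num) hhyp
  obtain ⟨N, ⟨μ, hμ⟩, hN⟩ := (hR.and_eventually (eventually_ge_atTop 1)).exists
  exact no_invariantWitness_half hN hμ

end ExactMonotoneRefutation

end

end Summit.AnomalousDissipation.AnomalousDissipation.Cruxes.QuarticTightness.StrategyCensus
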